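import Literature.NumberTheory.LFunctions.MatomakiRadziwillTaoTheorem13
import Literature.NumberTheory.LFunctions.MatomakiRadziwillTaoTheorem17
import Literature.NumberTheory.LFunctions.MatomakiRadziwillTaoPropA3
import Literature.NumberTheory.LFunctions.TaoLogChowlaProofs
import Literature.NumberTheory.LFunctions.TaoLogElliottProp24With
import Literature.NumberTheory.LFunctions.MatomakiRadziwillTaoPropA3With
import Literature.NumberTheory.LFunctions.MatomakiRadziwillTaoT2
import Literature.NumberTheory.LFunctions.MatomakiRadziwillTaoT2OfVK
import Literature.NumberTheory.LFunctions.VinogradovZetaSumEstimate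
import HarnessLib

/-!
# Matomäki–Radziwiłł–Tao 2015, Theorem 1.3: the assembled reduction to its two printed inputs

Topic `Literature/NumberTheory/LFunctions`.  Everything in this file is PROVED.  Sibling proof file of
`MatomakiRadziwillTaoTheorem13.lean`, whose `Tao2016.MatomakiRadziwillTao2015_theorem13` is Theorem 1.3 of
K. Matomäki, M. Radziwiłł, T. Tao, *An averaged form of Chowla's conjecture* (Algebra & Number Theory 9
(2015); arXiv:1503.05121): `sup_α ∫_0^X |∑_{x ≤ n ≤ x+H} λ(n) e(αn)| dx ≪ (log log H/log H + log^{-1/700} X) HX`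
for `10 ≤ H ≤ X`.  The paper proves it by "By (1.12), Theorem 1.7 implies Theorem 1.3" (§1), and the tree
proves every step of that sentence and of the two theorems behind it down to two named facts:

* Theorem 1.7 ⇐ Theorem A.2 (`MRT2015.MatomakiRadziwillTao2015_theorem17_of_theoremA2`,
  `MatomakiRadziwillTaoTheorem17.lean`: §§2–4 of the paper) ⇐ Proposition A.3
  (`MatomakiRadziwillTao2015_theoremA2_of_propA3`, `MatomakiRadziwillTaoPropA3.lean`: the Parseval step of
  Appendix A) — `MatomakiRadziwillTao2015_propA3`, the complex Matomäki–Radziwiłł mean value theorem for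
  the `𝒮`-restricted Dirichlet polynomial, is a NAMED FACT;
* (1.12) ⇐ Khale's explicit Vinogradov–Korobov region for `L(s, χ)`
  (`MatomakiRadziwillTao2015_liouvilleDistLowerBound_of_khale`, `TaoLogChowlaProofs.lean`) —
  `Khale2024_zeroFreeRegion` is a NAMED FACT (the paper's own pointer for (1.12): "established via
  standard methods from the Vinogradov-Korobov type zero-free region … for `L(s, χ)`").

Hence:

* `Tao2016.MatomakiRadziwillTao2015_theorem13_of_propA3_of_khale` — **Theorem 1.3 from Proposition A.3
  and Khale's Theorem 1.1**, the closed form of the reduction.  A discharge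
  `MatomakiRadziwillTao2015_theorem13_holds` is exactly the conjunction of discharges of these two facts,
  each of which is a theory of its own (Vinogradov's mean value theorem and Ford's zero detector for the
  second; Matomäki–Radziwiłł's Proposition 1 for complex twisted `f` for the first).

## Theorem 1.3 on the chain with an abstract middle term (second part of the file)

The rate `e^{-M/20}` of Theorem 1.7 is immaterial for Theorem 1.3: (1.12) gives
`M(λ; X, Q) ≥ (1/3 - ε) log log X - C_ε` for every `ε > 0`, so Theorem 1.7 for `g = λ` with ANY rate
`e^{-M/κ}`, `0 < κ < 700/3`, already yields the printed `log^{-1/700} X` (take `ε = 1/3 - κ/700`: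
`e^{-M/κ} ≤ e^{C_ε/κ} log^{-1/700} X`).  This puts Theorem 1.3 on the tree's chain with an abstract middle
term — `MRT2015.PropA3With mid ⟹ MRT2015.TheoremA2With mid ⟹` Theorem 1.7 with `e^{-M/120}`
(`MRT2015.A2With.theorem17With`, major arcs under `W ≤ e^{M/12}`) — on which Proposition A.3 is being
discharged in the form that Halász's theorem for block-restricted sums affords (middle term
`C (1 + M) e^{-M/2}`, see `MatomakiRadziwillTaoPropA3With.lean`, `MatomakiRadziwillTaoSiftedDistance.lean` §Status):

* `Tao2016.MatomakiRadziwillTao2015_theorem13_of_rate` — Theorem 1.7 for `λ` with rate `e^{-M/κ}`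
  (`0 < κ < 700/3`) and (1.12) imply Theorem 1.3;
* `Tao2016.MatomakiRadziwillTao2015_theorem13_of_theoremA2With` (hypothesis (1.12)),
  `Tao2016.MatomakiRadziwillTao2015_theorem13_of_theoremA2With_of_khale`,
  `Tao2016.MatomakiRadziwillTao2015_theorem13_of_propA3With_of_khale` — Theorem 1.3 from the schema
  (`mid ≥ 0`, antitone on `[1, ∞)`, `√(mid(12 log W - 48)) ≤ C_m W^{-5/4}` for `W ≥ W₁`) and (1.12), resp.
  Khale's region;
* `Tao2016.MatomakiRadziwillTao2015_theorem13_of_propA3With_exp_half` (hypothesis (1.12)) and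
  `Tao2016.MatomakiRadziwillTao2015_theorem13_of_propA3With_exp_half_of_khale` — **Theorem 1.3 from
  Proposition A.3 (completely multiplicative `f`) with middle term `C (1 + M) e^{-M/2}` and Khale's
  Theorem 1.1**: the closing move for `MatomakiRadziwillTao2015_theorem13_holds` once that instance of
  Proposition A.3 and `Khale2024_zeroFreeRegion` are theorems (`mid_exp_half_antitone`, `mid_exp_half_decay`
  record the admissibility of this middle term, as computed in `TaoLogElliottProp24With.lean`).

## Theorem 1.3 from the Vinogradov–Korobov region alone (third part of the file)

`MatomakiRadziwillTaoT2.lean` proves that instance of Proposition A.3 from Khale's region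
(`MRT2015.propA3With_exp_half_of_khale : Khale2024_zeroFreeRegion → ∃ K ≥ 0, PropA3With (K (1 + M) e^{-M/2})`:
Matomäki–Radziwiłł §8 for complex `f` on `𝒯₂`, restricted Halász on the window).  Hence

* `Tao2016.MatomakiRadziwillTao2015_theorem13_of_khale` — **Theorem 1.3 from Khale's Theorem 1.1 ALONE**: the
  named fact `MatomakiRadziwillTao2015_theorem13` is reduced to the single named fact `Khale2024_zeroFreeRegion`
  (the Vinogradov–Korobov zero-free region for `L(s, χ)`, the paper's own pointer for (1.12));
* `Tao2016.MatomakiRadziwillTao2015_theorem13_of_theoremA2With_of_vk`, `…_of_propA3With_of_vk`,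
  `…_of_propA3With_exp_half_of_vk` — the (1.12)-side of the reduction from ANY Vinogradov–Korobov region
  `HasVKZeroFreeRegion c T₀`, `c > 0` (`MatomakiRadziwillTao2015_liouvilleDistLowerBound_of_vk`), the form in
  which the region is dischargeable from Vinogradov's exponential-sum estimate
  (`hasVKZeroFreeRegion_of_vinogradovRange`, `ExpSumBoundReduction.lean`); and
  `…_of_propA3With_exp_half_of_vinogradovRange` — the same from `VinogradovRangeBound K C c` directly.

## Theorem 1.3 unconditionally (fourth part of the file)

Both inputs are now theorems of the tree: `MatomakiRadziwillTaoT2OfVK.lean` proves that instance of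
Proposition A.3 from ANY Vinogradov–Korobov region (`MRT2015.propA3With_exp_half_of_vk`), and
`VinogradovZetaSumEstimate.lean` proves the region itself (`VKZeta.exists_hasVKZeroFreeRegion :
∃ c > 0, HasVKZeroFreeRegion c 21` — Ivić's Theorem 6.2 by Korobov's method from Vinogradov's mean value theorem,
then Richert-type bounds and Landau's deduction, all proved in the tree).  Hence

* `Tao2016.MatomakiRadziwillTao2015_theorem13_of_vk` — Theorem 1.3 from ANY Vinogradov–Korobov region
  `HasVKZeroFreeRegion c T₀`, `c > 0`; `…_of_vinogradovRange`, `…_of_expSumBound`, `…_of_vmvt` — the same from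
  Vinogradov's zeta-sum estimate in its natural range, from Ford's shape `ExpSumBound C D`, and from Vinogradov's
  mean value theorem in the shape `VMVTBound A` (`A ≥ 1`);
* `Tao2016.MatomakiRadziwillTao2015_theorem13_holds` — **Theorem 1.3 of Matomäki–Radziwiłł–Tao, unconditionally**:
  the discharge of the named fact `MatomakiRadziwillTao2015_theorem13`.

## References
* K. Matomäki, M. Radziwiłł, T. Tao, Algebra & Number Theory 9 (2015) 2167–2196; arXiv:1503.05121:
  Theorem 1.3, Theorem 1.7, (1.12), Appendix A (Theorem A.2, Proposition A.3, Lemma A.4).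
* T. Khale, Q. J. Math. 75 (2024), 299–332, Theorem 1.1 and (1.4).
* A. Ivić, *The Riemann Zeta-Function*, Wiley 1985, Theorems 6.1–6.2, Lemma 6.3 (via `VinogradovZetaSumEstimate.lean`).
* K. Ford, Proc. LMS 85 (2002), Theorem 2 and Lemma 7.3 (the shapes `ExpSumBound`, `VinogradovRangeBound`).
-/

noncomputable section

namespace Literature.NumberTheory.LFunctions

namespace Tao2016

/-- **MRT 2015, Theorem 1.3 ⇐ Proposition A.3 + the Vinogradov–Korobov region for `L(s, χ)`.**
Theorem 1.3 (`MatomakiRadziwillTao2015_theorem13`) follows from the complex Matomäki–Radziwiłł mean value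
theorem `MatomakiRadziwillTao2015_propA3` (MRT 2015, Appendix A, Prop. A.3) and Khale's explicit
Vinogradov–Korobov zero-free region `Khale2024_zeroFreeRegion` (Q. J. Math. 75 (2024), Thm 1.1):
A.3 ⟹ A.2 ⟹ Theorem 1.7, Khale ⟹ (1.12), and "By (1.12), Theorem 1.7 implies Theorem 1.3".
[cite: MatomakiRadziwillTao2015, Theorem 1.3 (with Theorem 1.7, (1.12), Appendix A)]
[cite: Khale2024, Theorem 1.1] -/
theorem MatomakiRadziwillTao2015_theorem13_of_propA3_of_khale (hA3 : MatomakiRadziwillTao2015_propA3)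
    (hK : Khale2024_zeroFreeRegion) : MatomakiRadziwillTao2015_theorem13 :=
  MatomakiRadziwillTao2015_theorem13_of_theorem17
    (MRT2015.MatomakiRadziwillTao2015_theorem17_of_theoremA2 (MatomakiRadziwillTao2015_theoremA2_of_propA3 hA3))
    (MatomakiRadziwillTao2015_liouvilleDistLowerBound_of_khale hK)

/-! ### Theorem 1.3 from Theorem 1.7 for `λ` with an arbitrary rate `e^{-M/κ}` -/

open Finset Real

open MeasureTheory in
/-- **Theorem 1.3 from Theorem 1.7 for `λ` with rate `e^{-M/κ}` and (1.12).**  Suppose that for some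
`0 < κ < 700/3` and some `C`, for all `10 ≤ H ≤ X` and all `α`,
`∫_0^X |∑_{x ≤ n ≤ x+H} λ(n) e(αn)| dx ≤ C (e^{-M(λ; X, Q)/κ} + log log H/log H + log^{-1/700} X) HX`,
`Q = min(log^{1/125} X, log⁵ H)` (Theorem 1.7 for `g = λ`, with `κ = 20` as printed), and that (1.12) holds.
Then Theorem 1.3 holds: with `ε = 1/3 - κ/700 > 0` in (1.12), `M(λ; X, Q) ≥ (κ/700) log log X - C_ε` for
`X ≥ X₀`, so `e^{-M/κ} ≤ e^{C_ε/κ} log^{-1/700} X`; for `10 ≤ H ≤ X < X₀` the trivial bound `(H+1)X` is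
`≪_{X₀} log^{-1/700} X · HX`.  (Proof of `MatomakiRadziwillTao2015_theorem13_of_theorem17` with `20 ↦ κ`,
`1/6 ↦ 1/3 - κ/700`.) [cite: MatomakiRadziwillTao2015, §1 (sentence after Theorem 1.7: Theorem 1.7 and (1.12) imply Theorem 1.3)] -/
theorem MatomakiRadziwillTao2015_theorem13_of_rate {κ : ℝ} (hκ : 0 < κ) (hκ' : κ < 700 / 3)
    (h17 : ∃ C : ℝ, ∀ X H : ℝ, 10 ≤ H → H ≤ X → ∀ α : ℝ,
      ∫ x in (0 : ℝ)..X, ‖∑ n ∈ Finset.Icc ⌈x⌉₊ ⌊x + H⌋₊,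
          ((ArithmeticFunction.liouville n : ℤ) : ℂ) * VdC.e (α * n)‖
        ≤ C * (Real.exp (-(Sieve.nonpretentiousness (ArithmeticFunction.liouville : ArithmeticFunction ℂ) X
                (min (Real.log X ^ (1 / 125 : ℝ)) (Real.log H ^ (5 : ℝ)))) / κ)
              + Real.log (Real.log H) / Real.log H + 1 / Real.log X ^ (1 / 700 : ℝ)) * H * X)
    (h112 : MatomakiRadziwillTao2015_liouvilleDistLowerBound) :
    MatomakiRadziwillTao2015_theorem13 := by
  obtain ⟨C₁, hC₁⟩ := h17
  have hε : 0 < 1 / 3 - κ / 700 := by linarith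
  obtain ⟨C₂, X₀, h12⟩ := h112.pretentiousDistSq_ge (1 / 3 - κ / 700) hε
  set L : ArithmeticFunction ℂ := (ArithmeticFunction.liouville : ArithmeticFunction ℂ) with hL
  set X₁ : ℝ := max X₀ (Real.exp (Real.exp 1)) with hX₁
  have hX₁e : Real.exp (Real.exp 1) ≤ X₁ := le_max_right _ _
  have hX₁pos : 0 < X₁ := lt_of_lt_of_le (Real.exp_pos _) hX₁e
  have hlogX₁ : 1 ≤ Real.log X₁ := by
    have : Real.exp 1 ≤ Real.log X₁ := by
      rw [← Real.log_exp (Real.exp 1)]; exact Real.log_le_log (Real.exp_pos _) hX₁e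
    linarith [Real.add_one_le_exp (1 : ℝ)]
  set C₁' : ℝ := max C₁ 0 with hC₁'
  set K : ℝ := max (C₁' * (Real.exp (C₂ / κ) + 1)) (2 * Real.log X₁ ^ (1 / 700 : ℝ)) with hK
  refine ⟨K, fun H X hH hHX α => ?_⟩
  have hH0 : (0 : ℝ) < H := by linarith
  have hX0 : (0 : ℝ) < X := by linarith
  have hX10 : (10 : ℝ) ≤ X := hH.trans hHX
  have hlogX : 0 < Real.log X := Real.log_pos (by linarith)
  have hlogH1 : 1 ≤ Real.log H := by
    rw [← Real.log_exp 1]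
    exact Real.log_le_log (Real.exp_pos 1) (by have := Real.exp_one_lt_three; linarith)
  have hrate0 : 0 ≤ Real.log (Real.log H) / Real.log H + 1 / Real.log X ^ (1 / 700 : ℝ) := by
    have : 0 ≤ Real.log (Real.log H) := Real.log_nonneg hlogH1
    positivity
  have hrate1 : 1 / Real.log X ^ (1 / 700 : ℝ)
      ≤ Real.log (Real.log H) / Real.log H + 1 / Real.log X ^ (1 / 700 : ℝ) := by
    have : 0 ≤ Real.log (Real.log H) / Real.log H := div_nonneg (Real.log_nonneg hlogH1) (by linarith)
    linarith
  rcases le_or_gt X₁ X with hXX₁ | hXX₁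
  · -- large `X`: Theorem 1.7 (rate `e^{-M/κ}`) and (1.12)
    have hXX₀ : X₀ ≤ X := le_trans (le_max_left _ _) hXX₁
    have hlogX1 : 1 ≤ Real.log X := hlogX₁.trans (Real.log_le_log hX₁pos hXX₁)
    have h1 := hC₁ X H hH hHX α
    -- lower bound for `M(λ; X, Q)`
    set Q : ℝ := min (Real.log X ^ (1 / 125 : ℝ)) (Real.log H ^ (5 : ℝ)) with hQ
    have hQ1 : 1 ≤ Q := by
      rw [hQ, le_min_iff]
      exact ⟨Real.one_le_rpow hlogX1 (by norm_num), Real.one_le_rpow hlogH1 (by norm_num)⟩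
    have hQle : Q ≤ Real.log X ^ (1 / 125 : ℝ) := min_le_left _ _
    have hM : (1 / 3 - (1 / 3 - κ / 700)) * Real.log (Real.log X) - C₂ ≤ Sieve.nonpretentiousness L X Q := by
      unfold Sieve.nonpretentiousness Sieve.charNonpretentiousness
      haveI : Nonempty (Set.Icc 1 ⌊Q⌋₊) := ⟨⟨1, Set.mem_Icc.2 ⟨le_rfl, Nat.le_floor (by exact_mod_cast hQ1)⟩⟩⟩
      refine le_ciInf fun q => ?_
      haveI : Nonempty (DirichletCharacter ℂ (q : ℕ)) := ⟨1⟩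
      refine le_ciInf fun χ => ?_
      haveI : Nonempty (Set.Icc (-X) X) := ⟨⟨0, Set.mem_Icc.2 ⟨by linarith, hX0.le⟩⟩⟩
      refine le_ciInf fun t => ?_
      have hq := q.2
      rw [Set.mem_Icc] at hq
      refine h12 X hXX₀ q χ t hq.1 ?_ (abs_le.2 (Set.mem_Icc.1 t.2))
      calc ((q : ℕ) : ℝ) ≤ ⌊Q⌋₊ := by exact_mod_cast hq.2
        _ ≤ Q := Nat.floor_le (by linarith)
        _ ≤ Real.log X ^ (1 / 125 : ℝ) := hQle
    have hexp : Real.exp (-(Sieve.nonpretentiousness L X Q) / κ) ≤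
        Real.exp (C₂ / κ) * (1 / Real.log X ^ (1 / 700 : ℝ)) := by
      have h2 : -(Sieve.nonpretentiousness L X Q) / κ ≤ C₂ / κ + (-(1 / 700)) * Real.log (Real.log X) := by
        rw [div_le_iff₀ hκ]
        have e : (C₂ / κ + (-(1 / 700)) * Real.log (Real.log X)) * κ =
            C₂ - κ / 700 * Real.log (Real.log X) := by
          field_simp
          ring
        rw [e]
        linarith
      calc Real.exp (-(Sieve.nonpretentiousness L X Q) / κ)
          ≤ Real.exp (C₂ / κ + (-(1 / 700)) * Real.log (Real.log X)) := Real.exp_le_exp.2 h2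
        _ = Real.exp (C₂ / κ) * Real.log X ^ (-(1 / 700) : ℝ) := by
            rw [Real.exp_add, Real.rpow_def_of_pos hlogX, mul_comm (Real.log (Real.log X))]
        _ = Real.exp (C₂ / κ) * (1 / Real.log X ^ (1 / 700 : ℝ)) := by
            rw [Real.rpow_neg hlogX.le, inv_eq_one_div]
    have hHX0 : 0 ≤ (H : ℝ) * X := by positivity
    set E : ℝ := Real.exp (-(Sieve.nonpretentiousness L X Q) / κ)
      + Real.log (Real.log H) / Real.log H + 1 / Real.log X ^ (1 / 700 : ℝ) with hE
    have hE0 : 0 ≤ E := by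
      have := Real.exp_pos (-(Sieve.nonpretentiousness L X Q) / κ); rw [hE]; linarith
    have h1' : ∫ x in (0 : ℝ)..X, ‖∑ n ∈ Finset.Icc ⌈x⌉₊ ⌊x + H⌋₊,
        ((ArithmeticFunction.liouville n : ℤ) : ℂ) * VdC.e (α * n)‖ ≤ C₁' * E * H * X := by
      refine h1.trans ?_
      have e : ∀ c : ℝ, c * E * H * X = c * (E * (H * X)) := fun c => by ring
      rw [e, e]
      exact mul_le_mul_of_nonneg_right (le_max_left _ _) (mul_nonneg hE0 hHX0)
    calc ∫ x in (0 : ℝ)..X, ‖∑ n ∈ Finset.Icc ⌈x⌉₊ ⌊x + H⌋₊,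
          ((ArithmeticFunction.liouville n : ℤ) : ℂ) * VdC.e (α * n)‖
        ≤ C₁' * E * H * X := h1'
      _ ≤ C₁' * ((Real.exp (C₂ / κ) + 1)
            * (Real.log (Real.log H) / Real.log H + 1 / Real.log X ^ (1 / 700 : ℝ))) * H * X := by
          have hC0 : 0 ≤ C₁' := le_max_right _ _
          apply mul_le_mul_of_nonneg_right _ hX0.le
          apply mul_le_mul_of_nonneg_right _ hH0.le
          apply mul_le_mul_of_nonneg_left _ hC0
          rw [hE]
          have := mul_le_mul_of_nonneg_left hrate1 (Real.exp_pos (C₂ / κ)).le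
          nlinarith [hexp, hrate0]
      _ = (C₁' * (Real.exp (C₂ / κ) + 1))
            * (Real.log (Real.log H) / Real.log H + 1 / Real.log X ^ (1 / 700 : ℝ)) * H * X := by ring
      _ ≤ K * (Real.log (Real.log H) / Real.log H + 1 / Real.log X ^ (1 / 700 : ℝ)) * H * X := by
          apply mul_le_mul_of_nonneg_right _ hX0.le
          apply mul_le_mul_of_nonneg_right _ hH0.le
          exact mul_le_mul_of_nonneg_right (le_max_left _ _) hrate0
  · -- small `X`: trivial bound
    have hbound : ∀ x ∈ Set.uIoc (0 : ℝ) X, ‖(‖∑ n ∈ Finset.Icc ⌈x⌉₊ ⌊x + H⌋₊,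
        ((ArithmeticFunction.liouville n : ℤ) : ℂ) * VdC.e (α * n)‖)‖ ≤ H + 1 := by
      intro x hx
      rw [Set.uIoc_of_le hX0.le] at hx
      rw [norm_norm]
      refine (norm_sum_le _ _).trans ?_
      calc ∑ n ∈ Finset.Icc ⌈x⌉₊ ⌊x + H⌋₊, ‖((ArithmeticFunction.liouville n : ℤ) : ℂ) * VdC.e (α * n)‖
          ≤ ∑ n ∈ Finset.Icc ⌈x⌉₊ ⌊x + H⌋₊, (1 : ℝ) := by
            refine sum_le_sum fun n _ => ?_
            rw [norm_mul, VdC.norm_e, mul_one]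
            rw [← ArithmeticFunction.intCoe_apply]; exact norm_liouville_complex_le_one n
        _ = #(Finset.Icc ⌈x⌉₊ ⌊x + H⌋₊) := by simp
        _ ≤ H + 1 := card_Icc_ceil_floor_le hx.1.le hH0.le
    have h1 := intervalIntegral.norm_integral_le_of_norm_le_const hbound
    rw [Real.norm_eq_abs, sub_zero, abs_of_pos hX0] at h1
    have h2 : ∫ x in (0 : ℝ)..X, ‖∑ n ∈ Finset.Icc ⌈x⌉₊ ⌊x + H⌋₊,
        ((ArithmeticFunction.liouville n : ℤ) : ℂ) * VdC.e (α * n)‖ ≤ (H + 1) * X := (le_abs_self _).trans h1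
    -- `(H+1) X ≤ 2 log^{1/700} X₁ · log^{-1/700} X · H X`
    have hlogle : Real.log X ≤ Real.log X₁ := Real.log_le_log hX0 hXX₁.le
    have hr : 1 ≤ Real.log X₁ ^ (1 / 700 : ℝ) * (1 / Real.log X ^ (1 / 700 : ℝ)) := by
      rw [mul_one_div, le_div_iff₀ (Real.rpow_pos_of_pos hlogX _), one_mul]
      exact Real.rpow_le_rpow hlogX.le hlogle (by norm_num)
    calc ∫ x in (0 : ℝ)..X, ‖∑ n ∈ Finset.Icc ⌈x⌉₊ ⌊x + H⌋₊,
          ((ArithmeticFunction.liouville n : ℤ) : ℂ) * VdC.e (α * n)‖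
        ≤ (H + 1) * X := h2
      _ ≤ 2 * H * X := by nlinarith
      _ ≤ 2 * H * X * (Real.log X₁ ^ (1 / 700 : ℝ) * (1 / Real.log X ^ (1 / 700 : ℝ))) :=
          le_mul_of_one_le_right (by positivity) hr
      _ = (2 * Real.log X₁ ^ (1 / 700 : ℝ)) * (1 / Real.log X ^ (1 / 700 : ℝ)) * H * X := by ring
      _ ≤ K * (Real.log (Real.log H) / Real.log H + 1 / Real.log X ^ (1 / 700 : ℝ)) * H * X := by
          apply mul_le_mul_of_nonneg_right _ hX0.le
          apply mul_le_mul_of_nonneg_right _ hH0.le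
          exact mul_le_mul (le_max_right _ _) hrate1 (by positivity) (le_trans (by positivity) (le_max_right _ _))

/-! ### Theorem 1.3 on the chain `PropA3With mid ⟹ TheoremA2With mid ⟹ Theorem 1.7 (e^{-M/120})` -/

open MeasureTheory MRT2015 in
/-- **Theorem 1.3 from Theorem A.2 with middle term `mid` and (1.12).**  For any `mid : ℝ → ℝ` with
`mid ≥ 0` on `[0, ∞)`, antitone on `[1, ∞)`, and `√(mid(12 log W - 48)) ≤ C_m W^{-5/4}` for `W ≥ W₁`:
`TheoremA2With mid →` (1.12) `→` Theorem 1.3 — Theorem 1.7 with `e^{-M/120}` (`MRT2015.A2With.theorem17With`)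
specialised to `g = λ` (`Complex.exp (2πiαn) = e(αn)`) and `MatomakiRadziwillTao2015_theorem13_of_rate` with
`κ = 120 < 700/3`. [cite: MatomakiRadziwillTao2015, Theorem 1.3 (with Theorem 1.7, (1.12), Appendix A)] -/
theorem MatomakiRadziwillTao2015_theorem13_of_theoremA2With {mid : ℝ → ℝ}
    (hmid0 : ∀ M : ℝ, 0 ≤ M → 0 ≤ mid M) (hanti : ∀ a b : ℝ, 1 ≤ a → a ≤ b → mid b ≤ mid a)
    (hA2 : TheoremA2With mid) {Cm W₁ : ℝ} (hCm : 0 ≤ Cm)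
    (hdecay : ∀ W : ℝ, W₁ ≤ W → Real.sqrt (mid (12 * Real.log W - 48)) ≤ Cm * W ^ (-(5 : ℝ) / 4))
    (h112 : MatomakiRadziwillTao2015_liouvilleDistLowerBound) : MatomakiRadziwillTao2015_theorem13 := by
  obtain ⟨C, hC⟩ := A2With.theorem17With hmid0 hanti hA2 hCm hdecay
  refine MatomakiRadziwillTao2015_theorem13_of_rate (κ := 120) (by norm_num) (by norm_num) ⟨C, ?_⟩ h112
  intro X H hH hHX α
  set L : ArithmeticFunction ℂ := (ArithmeticFunction.liouville : ArithmeticFunction ℂ) with hL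
  -- the integrand of Theorem 1.7 for `g = λ` is that of Theorem 1.3
  have hint : ∀ x : ℝ, (∑ n ∈ Finset.Icc ⌈x⌉₊ ⌊x + H⌋₊,
      L n * Complex.exp (2 * Real.pi * Complex.I * (α : ℂ) * (n : ℂ)))
      = ∑ n ∈ Finset.Icc ⌈x⌉₊ ⌊x + H⌋₊, ((ArithmeticFunction.liouville n : ℤ) : ℂ) * VdC.e (α * n) := by
    intro x
    refine sum_congr rfl fun n _ => ?_
    rw [hL, ArithmeticFunction.intCoe_apply, VdC.e]
    congr 1
    congr 1
    push_cast
    ring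
  have h1 := hC L isMultiplicative_liouville_complex norm_liouville_complex_le_one X H hH hHX α
  simp only [hint] at h1
  exact h1

open MRT2015 in
/-- **Theorem 1.3 from Theorem A.2 with middle term `mid` and Khale's Theorem 1.1**: (1.12) from Khale's
explicit Vinogradov–Korobov region (`MatomakiRadziwillTao2015_liouvilleDistLowerBound_of_khale`), then
`MatomakiRadziwillTao2015_theorem13_of_theoremA2With`.
[cite: MatomakiRadziwillTao2015, Theorem 1.3 (with Theorem 1.7, (1.12), Appendix A)] [cite: Khale2024, Theorem 1.1] -/
theorem MatomakiRadziwillTao2015_theorem13_of_theoremA2With_of_khale {mid : ℝ → ℝ}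
    (hmid0 : ∀ M : ℝ, 0 ≤ M → 0 ≤ mid M) (hanti : ∀ a b : ℝ, 1 ≤ a → a ≤ b → mid b ≤ mid a)
    (hA2 : TheoremA2With mid) {Cm W₁ : ℝ} (hCm : 0 ≤ Cm)
    (hdecay : ∀ W : ℝ, W₁ ≤ W → Real.sqrt (mid (12 * Real.log W - 48)) ≤ Cm * W ^ (-(5 : ℝ) / 4))
    (hK : Khale2024_zeroFreeRegion) : MatomakiRadziwillTao2015_theorem13 :=
  MatomakiRadziwillTao2015_theorem13_of_theoremA2With hmid0 hanti hA2 hCm hdecay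
    (MatomakiRadziwillTao2015_liouvilleDistLowerBound_of_khale hK)

open MRT2015 in
/-- **Theorem 1.3 from Proposition A.3 with middle term `mid` and Khale's Theorem 1.1**
(`MRT2015.theoremA2With_of_propA3With`: the Parseval step of Appendix A with the abstract middle term, then
`MatomakiRadziwillTao2015_theorem13_of_theoremA2With_of_khale`).
[cite: MatomakiRadziwillTao2015, Theorem 1.3 (with Theorem 1.7, (1.12), Appendix A)] [cite: Khale2024, Theorem 1.1] -/
theorem MatomakiRadziwillTao2015_theorem13_of_propA3With_of_khale {mid : ℝ → ℝ}
    (hmid0 : ∀ M : ℝ, 0 ≤ M → 0 ≤ mid M) (hanti : ∀ a b : ℝ, 1 ≤ a → a ≤ b → mid b ≤ mid a)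
    (hA3 : PropA3With mid) {Cm W₁ : ℝ} (hCm : 0 ≤ Cm)
    (hdecay : ∀ W : ℝ, W₁ ≤ W → Real.sqrt (mid (12 * Real.log W - 48)) ≤ Cm * W ^ (-(5 : ℝ) / 4))
    (hK : Khale2024_zeroFreeRegion) : MatomakiRadziwillTao2015_theorem13 :=
  MatomakiRadziwillTao2015_theorem13_of_theoremA2With_of_khale hmid0 hanti
    (theoremA2With_of_propA3With hmid0 hA3) hCm hdecay hK

/-- The restricted-Halász middle term `C (1 + M) e^{-M/2}` (`C ≥ 0`) is antitone on `[1, ∞)`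
(`TaoLogElliottProp24With`'s `one_add_mul_exp_neg_half_antitone`). [folklore] -/
theorem mid_exp_half_antitone {C : ℝ} (hC : 0 ≤ C) {a b : ℝ} (ha : 1 ≤ a) (hab : a ≤ b) :
    C * (1 + b) * Real.exp (-b / 2) ≤ C * (1 + a) * Real.exp (-a / 2) := by
  have key := one_add_mul_exp_neg_half_antitone ha hab
  calc C * (1 + b) * Real.exp (-b / 2) = C * ((1 + b) * Real.exp (-b / 2)) := by ring
    _ ≤ C * ((1 + a) * Real.exp (-a / 2)) := mul_le_mul_of_nonneg_left key hC
    _ = C * (1 + a) * Real.exp (-a / 2) := by ring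

/-- The decay of the restricted-Halász middle term along `M = 12 log W - 48`:
`√(C (12 log W - 47) e^{24} W^{-6}) ≤ √(12 C e^{24}) W^{-5/4}` for `W ≥ e⁴` (`log W ≤ W^{1/2}`,
`W^{1/2 - 6} ≤ W^{-5/2}`); the computation of `Tao2016_prop24_of_theoremA2With_exp_half`
(`TaoLogElliottProp24With.lean`) recorded as a lemma. [folklore] -/
theorem mid_exp_half_decay {C : ℝ} (hC : 0 ≤ C) {W : ℝ} (hW : Real.exp 4 ≤ W) :
    Real.sqrt (C * (1 + (12 * Real.log W - 48)) * Real.exp (-(12 * Real.log W - 48) / 2)) ≤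
      Real.sqrt (12 * C * Real.exp 24) * W ^ (-(5 : ℝ) / 4) := by
  have hW4 : 4 ≤ Real.log W := by
    rw [← Real.log_exp 4]; exact Real.log_le_log (Real.exp_pos 4) hW
  have hW1 : 1 ≤ W := le_trans (Real.one_le_exp (by norm_num)) hW
  have hW0 : 0 < W := by linarith
  -- `e^{-(12 log W - 48)/2} = e^{24} W^{-6}`
  have he : Real.exp (-(12 * Real.log W - 48) / 2) = Real.exp 24 * W ^ (-(6 : ℝ)) := by
    rw [show -(12 * Real.log W - 48) / 2 = 24 + (-(6 : ℝ)) * Real.log W by ring, Real.exp_add,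
      Real.rpow_def_of_pos hW0, mul_comm (Real.log W)]
  have hlog_le : Real.log W ≤ W ^ (1 / 2 : ℝ) := log_le_sqrt_rpow hW1
  have hfac : C * (1 + (12 * Real.log W - 48)) * Real.exp (-(12 * Real.log W - 48) / 2) ≤
      (12 * C * Real.exp 24) * (W ^ (1 / 2 : ℝ) * W ^ (-(6 : ℝ))) := by
    rw [he]
    have h1 : 1 + (12 * Real.log W - 48) ≤ 12 * W ^ (1 / 2 : ℝ) := by linarith
    have h0 : 0 ≤ Real.exp 24 * W ^ (-(6 : ℝ)) := by positivity
    calc C * (1 + (12 * Real.log W - 48)) * (Real.exp 24 * W ^ (-(6 : ℝ)))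
        ≤ C * (12 * W ^ (1 / 2 : ℝ)) * (Real.exp 24 * W ^ (-(6 : ℝ))) := by
          refine mul_le_mul_of_nonneg_right (mul_le_mul_of_nonneg_left h1 hC) h0
      _ = (12 * C * Real.exp 24) * (W ^ (1 / 2 : ℝ) * W ^ (-(6 : ℝ))) := by ring
  have hpow : W ^ (1 / 2 : ℝ) * W ^ (-(6 : ℝ)) ≤ (W ^ (-(5 : ℝ) / 4)) ^ 2 := by
    rw [← Real.rpow_add hW0, ← Real.rpow_natCast, ← Real.rpow_mul hW0.le]
    norm_num
    exact Real.rpow_le_rpow_of_exponent_le hW1 (by norm_num)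
  have hsq : C * (1 + (12 * Real.log W - 48)) * Real.exp (-(12 * Real.log W - 48) / 2) ≤
      (Real.sqrt (12 * C * Real.exp 24) * W ^ (-(5 : ℝ) / 4)) ^ 2 := by
    rw [mul_pow, Real.sq_sqrt (by positivity)]
    exact hfac.trans (mul_le_mul_of_nonneg_left hpow (by positivity))
  calc Real.sqrt (C * (1 + (12 * Real.log W - 48)) * Real.exp (-(12 * Real.log W - 48) / 2))
      ≤ Real.sqrt ((Real.sqrt (12 * C * Real.exp 24) * W ^ (-(5 : ℝ) / 4)) ^ 2) := Real.sqrt_le_sqrt hsq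
    _ = Real.sqrt (12 * C * Real.exp 24) * W ^ (-(5 : ℝ) / 4) := Real.sqrt_sq (by positivity)

open MRT2015 in
/-- **Theorem 1.3 from Proposition A.3 (completely multiplicative `f`, middle term `C (1 + M) e^{-M/2}`,
`C ≥ 0`) and (1.12)**: the middle term is admissible (`mid_exp_half_antitone`, `mid_exp_half_decay` with
`C_m = √(12 C e^{24})`, `W₁ = e⁴`). [cite: MatomakiRadziwillTao2015, Theorem 1.3 (with Theorem 1.7, (1.12), Appendix A, Proposition A.3)] -/
theorem MatomakiRadziwillTao2015_theorem13_of_propA3With_exp_half {C : ℝ} (hC : 0 ≤ C)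
    (hA3 : PropA3With (fun M => C * (1 + M) * Real.exp (-M / 2)))
    (h112 : MatomakiRadziwillTao2015_liouvilleDistLowerBound) : MatomakiRadziwillTao2015_theorem13 :=
  MatomakiRadziwillTao2015_theorem13_of_theoremA2With (mid := fun M => C * (1 + M) * Real.exp (-M / 2))
    (fun M hM => by positivity) (fun a b ha hab => mid_exp_half_antitone hC ha hab)
    (theoremA2With_of_propA3With (fun M hM => by positivity) hA3)
    (Cm := Real.sqrt (12 * C * Real.exp 24)) (W₁ := Real.exp 4) (Real.sqrt_nonneg _)
    (fun W hW => mid_exp_half_decay hC hW) h112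

open MRT2015 in
/-- **MRT 2015, Theorem 1.3 ⇐ Proposition A.3 (completely multiplicative `f`, middle term
`C (1 + M) e^{-M/2}`) + Khale's Theorem 1.1** — the closing move for
`MatomakiRadziwillTao2015_theorem13_holds` on the restricted-Halász chain: once
`MRT2015.PropA3With (fun M => C * (1 + M) * Real.exp (-M / 2))` (some `C ≥ 0`) and
`Khale2024_zeroFreeRegion` are theorems, Theorem 1.3 is this term applied to them.
[cite: MatomakiRadziwillTao2015, Theorem 1.3 (with Theorem 1.7, (1.12), Appendix A, Proposition A.3)]
[cite: Khale2024, Theorem 1.1] -/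
theorem MatomakiRadziwillTao2015_theorem13_of_propA3With_exp_half_of_khale {C : ℝ} (hC : 0 ≤ C)
    (hA3 : PropA3With (fun M => C * (1 + M) * Real.exp (-M / 2))) (hK : Khale2024_zeroFreeRegion) :
    MatomakiRadziwillTao2015_theorem13 :=
  MatomakiRadziwillTao2015_theorem13_of_propA3With_exp_half hC hA3
    (MatomakiRadziwillTao2015_liouvilleDistLowerBound_of_khale hK)


/-! ### Theorem 1.3 from any Vinogradov–Korobov region, and from Khale's Theorem 1.1 alone -/

open MRT2015 in
/-- (From any Vinogradov–Korobov region `HasVKZeroFreeRegion c T₀`, `c > 0`.)  **Theorem 1.3 from Theorem A.2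
with middle term `mid` and a Vinogradov–Korobov region**: (1.12) from the region
(`MatomakiRadziwillTao2015_liouvilleDistLowerBound_of_vk`), then `MatomakiRadziwillTao2015_theorem13_of_theoremA2With`.
[cite: MatomakiRadziwillTao2015, Theorem 1.3 (with Theorem 1.7, (1.12), Appendix A)] -/
theorem MatomakiRadziwillTao2015_theorem13_of_theoremA2With_of_vk {mid : ℝ → ℝ}
    (hmid0 : ∀ M : ℝ, 0 ≤ M → 0 ≤ mid M) (hanti : ∀ a b : ℝ, 1 ≤ a → a ≤ b → mid b ≤ mid a)
    (hA2 : TheoremA2With mid) {Cm W₁ : ℝ} (hCm : 0 ≤ Cm)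
    (hdecay : ∀ W : ℝ, W₁ ≤ W → Real.sqrt (mid (12 * Real.log W - 48)) ≤ Cm * W ^ (-(5 : ℝ) / 4))
    {c T₀ : ℝ} (hc : 0 < c) (hVK : HasVKZeroFreeRegion c T₀) : MatomakiRadziwillTao2015_theorem13 :=
  MatomakiRadziwillTao2015_theorem13_of_theoremA2With hmid0 hanti hA2 hCm hdecay
    (MatomakiRadziwillTao2015_liouvilleDistLowerBound_of_vk hc hVK)

open MRT2015 in
/-- (From any Vinogradov–Korobov region `HasVKZeroFreeRegion c T₀`, `c > 0`.)  **Theorem 1.3 from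
Proposition A.3 with middle term `mid` and a Vinogradov–Korobov region** (`MRT2015.theoremA2With_of_propA3With`,
then `MatomakiRadziwillTao2015_theorem13_of_theoremA2With_of_vk`).
[cite: MatomakiRadziwillTao2015, Theorem 1.3 (with Theorem 1.7, (1.12), Appendix A)] -/
theorem MatomakiRadziwillTao2015_theorem13_of_propA3With_of_vk {mid : ℝ → ℝ}
    (hmid0 : ∀ M : ℝ, 0 ≤ M → 0 ≤ mid M) (hanti : ∀ a b : ℝ, 1 ≤ a → a ≤ b → mid b ≤ mid a)
    (hA3 : PropA3With mid) {Cm W₁ : ℝ} (hCm : 0 ≤ Cm)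
    (hdecay : ∀ W : ℝ, W₁ ≤ W → Real.sqrt (mid (12 * Real.log W - 48)) ≤ Cm * W ^ (-(5 : ℝ) / 4))
    {c T₀ : ℝ} (hc : 0 < c) (hVK : HasVKZeroFreeRegion c T₀) : MatomakiRadziwillTao2015_theorem13 :=
  MatomakiRadziwillTao2015_theorem13_of_theoremA2With_of_vk hmid0 hanti
    (theoremA2With_of_propA3With hmid0 hA3) hCm hdecay hc hVK

open MRT2015 in
/-- (From any Vinogradov–Korobov region `HasVKZeroFreeRegion c T₀`, `c > 0`.)  **Theorem 1.3 from
Proposition A.3 (completely multiplicative `f`, middle term `C (1 + M) e^{-M/2}`, `C ≥ 0`) and a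
Vinogradov–Korobov region** — the closing move for `MatomakiRadziwillTao2015_theorem13_holds` on the
restricted-Halász chain once that instance of Proposition A.3 is proved from the region and the region from
Vinogradov's estimate. [cite: MatomakiRadziwillTao2015, Theorem 1.3 (with Theorem 1.7, (1.12), Appendix A, Proposition A.3)] -/
theorem MatomakiRadziwillTao2015_theorem13_of_propA3With_exp_half_of_vk {C : ℝ} (hC : 0 ≤ C)
    (hA3 : PropA3With (fun M => C * (1 + M) * Real.exp (-M / 2))) {c T₀ : ℝ} (hc : 0 < c)
    (hVK : HasVKZeroFreeRegion c T₀) : MatomakiRadziwillTao2015_theorem13 :=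
  MatomakiRadziwillTao2015_theorem13_of_propA3With_exp_half hC hA3
    (MatomakiRadziwillTao2015_liouvilleDistLowerBound_of_vk hc hVK)

open MRT2015 in
/-- **Theorem 1.3 from Proposition A.3 (middle term `C (1 + M) e^{-M/2}`) and Vinogradov's exponential-sum
estimate in its natural range** (`VinogradovRangeBound K C' c`, `K ≥ 1`, `C' ≥ 0`, `c > 0`;
`hasVKZeroFreeRegion_of_vinogradovRange`, `ExpSumBoundReduction.lean`).
[cite: MatomakiRadziwillTao2015, Theorem 1.3 (with Theorem 1.7, (1.12), Appendix A, Proposition A.3)]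
[cite: Ford2002, Theorem 2 and Lemma 7.3] -/
theorem MatomakiRadziwillTao2015_theorem13_of_propA3With_exp_half_of_vinogradovRange {C : ℝ} (hC : 0 ≤ C)
    (hA3 : PropA3With (fun M => C * (1 + M) * Real.exp (-M / 2))) {K : ℕ} (hK : 1 ≤ K) {C' c : ℝ}
    (hC' : 0 ≤ C') (hc : 0 < c) (hV : VinogradovRangeBound K C' c) : MatomakiRadziwillTao2015_theorem13 := by
  obtain ⟨c', hc', hVK⟩ := hasVKZeroFreeRegion_of_vinogradovRange hK hC' hc hV
  exact MatomakiRadziwillTao2015_theorem13_of_propA3With_exp_half_of_vk hC hA3 hc' hVK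

/-- **MRT 2015, Theorem 1.3, from Khale's Theorem 1.1 ALONE.**  `MatomakiRadziwillTaoT2.lean` proves
Proposition A.3 for completely multiplicative `f` with middle term `K (1 + M) e^{-M/2}` from Khale's explicit
Vinogradov–Korobov region (`MRT2015.propA3With_exp_half_of_khale`: the `𝒯₂` range by Matomäki–Radziwiłł's
Proposition 1 for the coefficients `f 1_𝒮` with Lemma A.4, the window `𝒯₀ ∪ 𝒯₁` by Halász's theorem for
block-restricted sums); with (1.12) from the same region this is Theorem 1.3
(`MatomakiRadziwillTao2015_theorem13_of_propA3With_exp_half_of_khale`).  So the named fact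
`MatomakiRadziwillTao2015_theorem13` rests on the single named fact `Khale2024_zeroFreeRegion`.
[cite: MatomakiRadziwillTao2015, Theorem 1.3 (with Theorem 1.7, (1.12), Appendix A, Proposition A.3, Lemma A.4)]
[cite: Khale2024, Theorem 1.1] -/
theorem MatomakiRadziwillTao2015_theorem13_of_khale (hK : Khale2024_zeroFreeRegion) :
    MatomakiRadziwillTao2015_theorem13 := by
  obtain ⟨K, hK0, hA3⟩ := MRT2015.propA3With_exp_half_of_khale hK
  exact MatomakiRadziwillTao2015_theorem13_of_propA3With_exp_half_of_khale hK0 hA3 hK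

/-! ### Theorem 1.3 unconditionally -/

/-- **MRT 2015, Theorem 1.3, from ANY Vinogradov–Korobov region** `HasVKZeroFreeRegion c T₀`, `c > 0`:
Proposition A.3 with middle term `K (1 + M) e^{-M/2}` from the region (`MRT2015.propA3With_exp_half_of_vk`,
`MatomakiRadziwillTaoT2OfVK.lean`: Matomäki–Radziwiłł §8 for complex `f` on `𝒯₂` with Lemma A.4, restricted
Halász on the window) and (1.12) from the region (`MatomakiRadziwillTao2015_liouvilleDistLowerBound_of_vk`), then
Theorem A.2, Theorem 1.7 with rate `e^{-M/120}` and `MatomakiRadziwillTao2015_theorem13_of_rate`.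
[cite: MatomakiRadziwillTao2015, Theorem 1.3 (with Theorem 1.7, (1.12), Appendix A, Proposition A.3, Lemma A.4)] -/
theorem MatomakiRadziwillTao2015_theorem13_of_vk {c T₀ : ℝ} (hc : 0 < c) (hVK : HasVKZeroFreeRegion c T₀) :
    MatomakiRadziwillTao2015_theorem13 := by
  obtain ⟨K, hK0, hA3⟩ := MRT2015.propA3With_exp_half_of_vk hc hVK
  exact MatomakiRadziwillTao2015_theorem13_of_propA3With_exp_half_of_vk hK0 hA3 hc hVK

/-- **MRT 2015, Theorem 1.3, from Vinogradov's estimate for the zeta sums** in its natural range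
(`VinogradovRangeBound K C c`, `K ≥ 1`, `C ≥ 0`, `c > 0`; `hasVKZeroFreeRegion_of_vinogradovRange`,
`ExpSumBoundReduction.lean`). [cite: MatomakiRadziwillTao2015, Theorem 1.3] [cite: Ford2002, Theorem 2 and Lemma 7.3] -/
theorem MatomakiRadziwillTao2015_theorem13_of_vinogradovRange {K : ℕ} (hK : 1 ≤ K) {C c : ℝ} (hC : 0 ≤ C)
    (hc : 0 < c) (hV : VinogradovRangeBound K C c) : MatomakiRadziwillTao2015_theorem13 := by
  obtain ⟨c', hc', hVK⟩ := hasVKZeroFreeRegion_of_vinogradovRange hK hC hc hV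
  exact MatomakiRadziwillTao2015_theorem13_of_vk hc' hVK

/-- **MRT 2015, Theorem 1.3, from Vinogradov's estimate in Ford's shape** `ExpSumBound C D` (`C ≥ 0`, `D > 0`;
`hasVKZeroFreeRegion_of_expSumBound`, `RichertBoundsFromExpSum.lean`).
[cite: MatomakiRadziwillTao2015, Theorem 1.3] [cite: Ford2002, Theorem 2] -/
theorem MatomakiRadziwillTao2015_theorem13_of_expSumBound {C D : ℝ} (h : ExpSumBound C D) (hC : 0 ≤ C)
    (hD : 0 < D) : MatomakiRadziwillTao2015_theorem13 := by
  obtain ⟨c, hc, hVK⟩ := hasVKZeroFreeRegion_of_expSumBound h hC hD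
  exact MatomakiRadziwillTao2015_theorem13_of_vk hc hVK

/-- **MRT 2015, Theorem 1.3, from Vinogradov's mean value theorem** in the shape of Ivić's Lemma 6.3
(`VMVTBound A`, `A ≥ 1`; `VKZeta.hasVKZeroFreeRegion_of_vmvt`: Ivić's Theorem 6.2, Richert-type bounds, Landau's
deduction). [cite: MatomakiRadziwillTao2015, Theorem 1.3] [cite: Ivic1985, Theorem 6.2 and Lemma 6.3] -/
theorem MatomakiRadziwillTao2015_theorem13_of_vmvt {A : ℝ} (hA : 1 ≤ A) (hV : VMVTBound A) :
    MatomakiRadziwillTao2015_theorem13 := by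
  obtain ⟨c, hc, hVK⟩ := VKZeta.hasVKZeroFreeRegion_of_vmvt hA hV
  exact MatomakiRadziwillTao2015_theorem13_of_vk hc hVK

/-- **Matomäki–Radziwiłł–Tao 2015, Theorem 1.3, unconditionally** — the discharge of the named fact
`Tao2016.MatomakiRadziwillTao2015_theorem13`:
`sup_α ∫_0^X |∑_{x ≤ n ≤ x+H} λ(n) e(αn)| dx ≪ (log log H / log H + log^{-1/700} X) H X` for `10 ≤ H ≤ X`.
The proof is the paper's ("By (1.12), Theorem 1.7 implies Theorem 1.3"), every step proved in the tree:
Theorem 1.7 (§§2–4: `MatomakiRadziwillTaoTheorem17*.lean`) from Theorem A.2, from Proposition A.3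
(Appendix A: Parseval; the complex Matomäki–Radziwiłł theorem on `𝒯₂` with Lemma A.4; Halász's theorem for
block-restricted sums on the window — `MatomakiRadziwillTaoT2OfVK.lean`); (1.12) from the twisted prime number
theorem (`TaoLogChowlaProofs.lean`); both from the Vinogradov–Korobov zero-free region for Dirichlet
`L`-functions, which `VinogradovZetaSumEstimate.lean` proves (`VKZeta.exists_hasVKZeroFreeRegion`: Vinogradov's
mean value theorem, Ivić's Theorem 6.2 by Korobov's method, Richert-type bounds for `L(s, χ)`, Landau).
[cite: MatomakiRadziwillTao2015, Theorem 1.3 (with Theorem 1.7, (1.12), Appendix A)]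
[cite: Ivic1985, Theorems 6.1–6.2 and Lemma 6.3] [cite: Khale2024, (1.4)] -/
theorem MatomakiRadziwillTao2015_theorem13_holds : MatomakiRadziwillTao2015_theorem13 := by
  obtain ⟨c, hc, hVK⟩ := VKZeta.exists_hasVKZeroFreeRegion
  exact MatomakiRadziwillTao2015_theorem13_of_vk hc hVK

end Tao2016

end Literature.NumberTheory.LFunctions

end
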